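import Literature.Geometry.Symplectic.SurfaceTubeScaling
import Literature.Geometry.Kaehler.FibrePrimitiveProductSmooth
import Literature.Geometry.Kaehler.ManifoldFormsPullback
import HarnessLib

/-!
# The relative Poincaré lemma on the tube of a symplectic surface

Topic `Literature/Geometry/Symplectic`; layer C5 of the construction of the symplectic tubular
neighbourhood with its `U(1)`-structure of a closed symplectic surface `b : S → N` in a
symplectic `4`-manifold (McLean, GAFA 2012, **Lemma 5.14**, `k = 1`), for the fact seat of
`Literature.Geometry.Symplectic.mclean_divisorComplement_convex_four`.

**Relative Poincaré lemma** (McDuff–Salamon 2017, Lemma 3.2.1 as used in Thm. 3.4.10): a closed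
`2`-form `τ` on the tube, smooth and closed on `N₁` and vanishing on `T_B N`, has a primitive
`prim τ` near the surface, smooth on the quarter tube `Tq`, with `d (prim τ) = τ` on `Tq` and
`prim τ = 0` at the points of the surface.  Construction by the **product trick**: pull `τ` back
along the fibre scaling `Sc : N × ℝ → N` (`SurfaceTubeScaling.lean`) to the closed form
`η = Sc^* τ` on `N × ℝ`, which vanishes on `N × {0}` (`Sc (·, 0)` factors through the surface);
apply the tree's fibre primitive of product manifolds (`fibrePrimitive`,
`FibrePrimitiveProductSmooth.lean`, here in a version local in the `N`-factor:
`smoothAt_fibrePrimitive_of_isOpen`, `mextDeriv_fibrePrimitive_of_isOpen`); restrict to the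
slice `t = 1` where `Sc (·, 1) = id`.

Everything here is proved; no named facts (D-0026).

## References

* D. McDuff, D. Salamon, *Introduction to Symplectic Topology*, 3rd ed. (2017), Lemma 3.2.1,
  Thm. 3.4.10. [McDuffSalamon2017]
* M. McLean, *The growth rate of symplectic homology and affine varieties*, GAFA 22 (2012),
  Lemma 5.14 (arXiv:1011.2542). [Mclean2012]
* R. Bott, L. W. Tu, *Differential Forms in Algebraic Topology* (1982), §I.4. [BottTu1982Forms]
-/

noncomputable section

open scoped Manifold ContDiff Topology RealInnerProductSpace
open Set Function Module Filter Metric MeasureTheory intervalIntegral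
open Literature.Topology.FourManifolds
open Literature.Geometry.Kaehler
open Literature.Geometry.Manifold

namespace Literature.Geometry.Symplectic

namespace SurfaceTube

/-! ### The fibre primitive of a form smooth on `O × J` (local version of the tree's lemmas) -/

section LocalFibrePrimitive

variable {m : ℕ} {F : Type*} [NormedAddCommGroup F] [NormedSpace ℝ F] [CompleteSpace F] {k : ℕ}
  {M : Type*} [TopologicalSpace M] [ChartedSpace (EuclideanSpace ℝ (Fin m)) M]
  [IsManifold (𝓡 m) ∞ M] {O : Set M} {J : Set ℝ}

omit [IsManifold (𝓡 m) ∞ M] in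
/-- The part of the chart target of `x₀` over the open set `O`. [folklore] -/
theorem isOpen_target_inter_preimage (hO : IsOpen O) (x₀ : M) :
    IsOpen ((extChartAt (𝓡 m) x₀).target ∩ (extChartAt (𝓡 m) x₀).symm ⁻¹' O) :=
  (continuousOn_extChartAt_symm x₀).isOpen_inter_preimage (isOpen_extChartAt_target x₀) hO

omit [CompleteSpace F] in
/-- The chart representative of a form smooth on `O × J` is `C^∞` on `(target ∩ chart⁻¹ O) × J`.
[folklore] -/
theorem contDiffOn_inChart_prod_of_isOpen {η : MForm ((𝓡 m).prod 𝓘(ℝ, ℝ)) (M × ℝ) F (k + 1)}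
    (hη : ∀ z : M × ℝ, z.1 ∈ O → z.2 ∈ J → η.SmoothAt z) (x₀ : M × ℝ) :
    ContDiffOn ℝ ∞ (η.inChart x₀)
      (((extChartAt (𝓡 m) x₀.1).target ∩ (extChartAt (𝓡 m) x₀.1).symm ⁻¹' O) ×ˢ J) := by
  intro y hy
  have hyt : y ∈ (extChartAt ((𝓡 m).prod 𝓘(ℝ, ℝ)) x₀).target :=
    mem_extChartAt_prod_real_target.2 hy.1.1
  set z := (extChartAt ((𝓡 m).prod 𝓘(ℝ, ℝ)) x₀).symm y with hz
  have hzs : z ∈ (extChartAt ((𝓡 m).prod 𝓘(ℝ, ℝ)) x₀).source :=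
    (extChartAt ((𝓡 m).prod 𝓘(ℝ, ℝ)) x₀).map_target hyt
  have hz1 : z.1 = (extChartAt (𝓡 m) x₀.1).symm y.1 := by rw [hz, extChartAt_prod_real_symm_eq]
  have hz2 : z.2 = y.2 := by rw [hz, extChartAt_prod_real_symm_eq]
  have hsm : η.SmoothAt z := hη z (hz1 ▸ hy.1.2) (hz2 ▸ hy.2)
  have h := MForm.SmoothAt.contDiffWithinAt_inChart hzs hsm
  rw [(extChartAt ((𝓡 m).prod 𝓘(ℝ, ℝ)) x₀).right_inv hyt, ModelWithCorners.Boundaryless.range_eq_univ]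
    at h
  exact h.mono (subset_univ _)

omit [CompleteSpace F] in
/-- **The fibre primitive of a form smooth on `O × J` is smooth on `O × J`** (`O ⊆ M` open,
`J ⊆ ℝ` open and star-shaped at `0`); local version of the tree's `smoothAt_fibrePrimitive`.
[cite: McDuffSalamon2017, Lemma 3.2.1] -/
theorem smoothAt_fibrePrimitive_of_isOpen {η : MForm ((𝓡 m).prod 𝓘(ℝ, ℝ)) (M × ℝ) F (k + 1)}
    (hO : IsOpen O) (hJ : IsOpen J) (hJst : ∀ s ∈ J, ∀ σ ∈ Icc (0 : ℝ) 1, σ * s ∈ J)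
    (hη : ∀ z : M × ℝ, z.1 ∈ O → z.2 ∈ J → η.SmoothAt z) {x₀ : M × ℝ} (hx₀O : x₀.1 ∈ O)
    (hx₀ : x₀.2 ∈ J) : (fibrePrimitive η).SmoothAt x₀ := by
  set W := (extChartAt (𝓡 m) x₀.1).target ∩ (extChartAt (𝓡 m) x₀.1).symm ⁻¹' O with hW
  set U : Set (EuclideanSpace ℝ (Fin m) × ℝ) := W ×ˢ J with hU
  have hUo : IsOpen U := (isOpen_target_inter_preimage hO x₀.1).prod hJ
  have hK : ContDiffOn ℝ ∞ (linHomOperator (vertQ m) (η.inChart x₀)) U :=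
    contDiffOn_linHomOperator (vertQ m) hUo (fun p hp σ hσ ↦ linHom_vertQ_mem_prod hJst hp σ hσ)
      (contDiffOn_inChart_prod_of_isOpen hη x₀)
  have hcentre : extChartAt ((𝓡 m).prod 𝓘(ℝ, ℝ)) x₀ x₀ ∈ U := by
    rw [extChartAt_prod]
    refine ⟨⟨mem_extChartAt_target (I := 𝓡 m) x₀.1, ?_⟩, by simpa using hx₀⟩
    show (extChartAt (𝓡 m) x₀.1).symm (extChartAt (𝓡 m) x₀.1 x₀.1) ∈ O
    rw [extChartAt_to_inv]; exact hx₀O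
  have heq : ∀ y ∈ U, (fibrePrimitive η).inChart x₀ y = linHomOperator (vertQ m) (η.inChart x₀) y :=
    fun y hy ↦ inChart_fibrePrimitive_eq η (mem_extChartAt_prod_real_target.2 hy.1.1)
  have hμ : ContDiffOn ℝ ∞ ((fibrePrimitive η).inChart x₀) U := hK.congr heq
  show ContDiffWithinAt ℝ ∞ ((fibrePrimitive η).inChart x₀) (range ((𝓡 m).prod 𝓘(ℝ, ℝ)))
    (extChartAt ((𝓡 m).prod 𝓘(ℝ, ℝ)) x₀ x₀)
  exact ((hμ _ hcentre).contDiffAt (hUo.mem_nhds hcentre)).contDiffWithinAt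

/-- **The fibre primitive of a closed form smooth on `O × J` and vanishing on `M × {0}` is a
primitive on `O × J`**: `d (fibrePrimitive η) = η` there; local version of the tree's
`mextDeriv_fibrePrimitive` (relative Poincaré lemma along the `ℝ`-factor).
[cite: McDuffSalamon2017, Lemma 3.2.1] -/
theorem mextDeriv_fibrePrimitive_of_isOpen {η : MForm ((𝓡 m).prod 𝓘(ℝ, ℝ)) (M × ℝ) F (k + 1)}
    (hO : IsOpen O) (hJ : IsOpen J) (hJst : ∀ s ∈ J, ∀ σ ∈ Icc (0 : ℝ) 1, σ * s ∈ J)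
    (hη : ∀ z : M × ℝ, z.1 ∈ O → z.2 ∈ J → η.SmoothAt z)
    (hcl : ∀ z : M × ℝ, z.1 ∈ O → z.2 ∈ J → mextDeriv η z = 0) (hzero : ∀ n : M, η (n, 0) = 0)
    {x₀ : M × ℝ} (hx₀O : x₀.1 ∈ O) (hx₀ : x₀.2 ∈ J) :
    mextDeriv (fibrePrimitive η) x₀ = η x₀ := by
  set W := (extChartAt (𝓡 m) x₀.1).target ∩ (extChartAt (𝓡 m) x₀.1).symm ⁻¹' O with hW
  set U : Set (EuclideanSpace ℝ (Fin m) × ℝ) := W ×ˢ J with hU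
  have hUo : IsOpen U := (isOpen_target_inter_preimage hO x₀.1).prod hJ
  have hst : ∀ p ∈ U, ∀ σ ∈ Icc (0 : ℝ) 1, linHom (vertQ m) σ p ∈ U :=
    fun p hp σ hσ ↦ linHom_vertQ_mem_prod hJst hp σ hσ
  have hβ : ContDiffOn ℝ ∞ (η.inChart x₀) U := contDiffOn_inChart_prod_of_isOpen hη x₀
  have hcentre : extChartAt ((𝓡 m).prod 𝓘(ℝ, ℝ)) x₀ x₀ ∈ U := by
    rw [extChartAt_prod]
    refine ⟨⟨mem_extChartAt_target (I := 𝓡 m) x₀.1, ?_⟩, by simpa using hx₀⟩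
    show (extChartAt (𝓡 m) x₀.1).symm (extChartAt (𝓡 m) x₀.1 x₀.1) ∈ O
    rw [extChartAt_to_inv]; exact hx₀O
  have heq : ∀ y ∈ U, (fibrePrimitive η).inChart x₀ y = linHomOperator (vertQ m) (η.inChart x₀) y :=
    fun y hy ↦ inChart_fibrePrimitive_eq η (mem_extChartAt_prod_real_target.2 hy.1.1)
  -- `extDeriv` of the representative of `η` vanishes on `U`
  have hd : ∀ y ∈ U, extDeriv (η.inChart x₀) y = 0 := by
    intro y hy
    have hyt : y ∈ (extChartAt ((𝓡 m).prod 𝓘(ℝ, ℝ)) x₀).target :=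
      mem_extChartAt_prod_real_target.2 hy.1.1
    set z := (extChartAt ((𝓡 m).prod 𝓘(ℝ, ℝ)) x₀).symm y with hz
    have hz1 : z.1 = (extChartAt (𝓡 m) x₀.1).symm y.1 := by rw [hz, extChartAt_prod_real_symm_eq]
    have hz2 : z.2 = y.2 := by rw [hz, extChartAt_prod_real_symm_eq]
    have hzO : z.1 ∈ O := hz1 ▸ hy.1.2
    have hzJ : z.2 ∈ J := hz2 ▸ hy.2
    have h := inChart_mextDeriv_of_mem_target η hyt (hη z hzO hzJ)
    rw [ModelWithCorners.Boundaryless.range_eq_univ, extDerivWithin_univ] at h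
    rw [← h, MForm.inChart_eq_of_mem_target _ hyt, hcl z hzO hzJ]
    exact ContinuousAlternatingMap.ext fun _ ↦ rfl
  -- `P^* (η.inChart x₀)` vanishes (`η = 0` on the zero section)
  have h0 : ∀ y ∈ U, ((η.inChart x₀)
      ((ContinuousLinearMap.id ℝ (EuclideanSpace ℝ (Fin m) × ℝ) - vertQ m) y)).compContinuousLinearMap
      (ContinuousLinearMap.id ℝ (EuclideanSpace ℝ (Fin m) × ℝ) - vertQ m) = 0 := by
    intro y hy
    have hP : (ContinuousLinearMap.id ℝ (EuclideanSpace ℝ (Fin m) × ℝ) - vertQ m) y = (y.1, (0 : ℝ)) :=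
      id_sub_inr_comp_snd_apply y
    have hyt : ((y.1, (0 : ℝ)) : EuclideanSpace ℝ (Fin m) × ℝ) ∈
        (extChartAt ((𝓡 m).prod 𝓘(ℝ, ℝ)) x₀).target := mem_extChartAt_prod_real_target.2 hy.1.1
    rw [hP, MForm.inChart_eq_of_mem_target _ hyt, extChartAt_prod_real_symm_eq]
    dsimp only
    rw [hzero]
    exact ContinuousAlternatingMap.ext fun _ ↦ rfl
  rw [mextDeriv_eq_extDerivWithin, ModelWithCorners.Boundaryless.range_eq_univ, extDerivWithin_univ]
  have hloc : extDeriv ((fibrePrimitive η).inChart x₀) (extChartAt ((𝓡 m).prod 𝓘(ℝ, ℝ)) x₀ x₀) =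
      extDeriv (linHomOperator (vertQ m) (η.inChart x₀)) (extChartAt ((𝓡 m).prod 𝓘(ℝ, ℝ)) x₀ x₀) :=
    Filter.EventuallyEq.extDeriv_eq (Filter.eventually_of_mem (hUo.mem_nhds hcentre) heq)
  rw [hloc, extDeriv_linHomOperator_of_closed_of_mapsTo (vertQ m) hUo hst hβ hd h0 hcentre,
    MForm.inChart_apply_self]

end LocalFibrePrimitive

/-! ### The relative Poincaré lemma on the tube -/

variable {N : Type*} [TopologicalSpace N] [ChartedSpace (EuclideanSpace ℝ (Fin 4)) N]
  [IsManifold (𝓡 4) ∞ N] {S : Type*} [TopologicalSpace S] [ChartedSpace (EuclideanSpace ℝ (Fin 2)) S]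
  [IsManifold (𝓡 2) ∞ S] {V : Type*} [NormedAddCommGroup V] [InnerProductSpace ℝ V]
  [FiniteDimensional ℝ V] (D : Setup N S V)

namespace Setup

variable [CompactSpace S] [Nonempty S] [T2Space S]

/-- **`η = Sc^* τ`**, the pull-back of a `2`-form on `N` along the fibre scaling. [folklore] -/
def η (τ : MForm (𝓡 4) N ℝ 2) : MForm ((𝓡 4).prod 𝓘(ℝ, ℝ)) (N × ℝ) ℝ 2 :=
  τ.pullback ((𝓡 4).prod 𝓘(ℝ, ℝ)) D.Sc

/-- **The fibre primitive `μ` of `η`** on `N × ℝ`. [cite: McDuffSalamon2017, Lemma 3.2.1] -/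
def μ (τ : MForm (𝓡 4) N ℝ 2) : MForm ((𝓡 4).prod 𝓘(ℝ, ℝ)) (N × ℝ) ℝ 1 := fibrePrimitive (D.η τ)

/-- The slice map `x ↦ (x, 1)`. [folklore] -/
def _root_.Literature.Geometry.Symplectic.SurfaceTube.ι₁ (x : N) : N × ℝ := (x, 1)

/-- **The primitive `prim τ = ι₁^* μ`** of `τ` near the surface. [cite: McDuffSalamon2017, Lemma 3.2.1] -/
def prim (τ : MForm (𝓡 4) N ℝ 2) : MForm (𝓡 4) N ℝ 1 := (D.μ τ).pullback (𝓡 4) ι₁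

omit [IsManifold (𝓡 4) ∞ N] in
/-- The slice map is smooth. [folklore] -/
theorem _root_.Literature.Geometry.Symplectic.SurfaceTube.contMDiff_ι₁ :
    ContMDiff (𝓡 4) ((𝓡 4).prod 𝓘(ℝ, ℝ)) ∞ (ι₁ : N → N × ℝ) :=
  contMDiff_id.prodMk contMDiff_const

variable {τ : MForm (𝓡 4) N ℝ 2}

/-- **`η` is smooth on `Tq × Jσ`** (for `τ` smooth on `N₁`). [folklore] -/
theorem smoothAt_η (hτs : ∀ x ∈ D.N₁, τ.SmoothAt x) {x : N} (hx : x ∈ D.Tq) {σ : ℝ} (hσ : σ ∈ Jσ) :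
    (D.η τ).SmoothAt (x, σ) :=
  MForm.SmoothAt.pullback (D.eventually_contMDiffAt_Sc hx hσ)
    (hτs _ (D.N₃_subset_N₁ (D.Sc_mem_N₃ hx hσ)))

/-- **`η` is closed on `Tq × Jσ`** (for `τ` smooth and closed on `N₁`). [folklore] -/
theorem mextDeriv_η (hτs : ∀ x ∈ D.N₁, τ.SmoothAt x) (hτc : ∀ x ∈ D.N₁, mextDeriv τ x = 0)
    {x : N} (hx : x ∈ D.Tq) {σ : ℝ} (hσ : σ ∈ Jσ) : mextDeriv (D.η τ) (x, σ) = 0 := by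
  have h1 := D.N₃_subset_N₁ (D.Sc_mem_N₃ hx hσ)
  rw [η, mextDeriv_pullback_apply (D.eventually_contMDiffAt_Sc hx hσ) (hτs _ h1)]
  show (mextDeriv τ (D.Sc (x, σ))).compContinuousLinearMap _ = 0
  rw [hτc _ h1]
  exact ContinuousAlternatingMap.ext fun _ ↦ rfl

/-- **`η` vanishes on the zero section** (for `τ` vanishing at the surface). [folklore] -/
theorem η_zero (hτ0 : ∀ y, τ (D.b y) = 0) (x : N) : D.η τ (x, 0) = 0 := by
  show (τ (D.Sc (x, 0))).compContinuousLinearMap _ = 0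
  rw [D.Sc_zero x, hτ0]
  exact ContinuousAlternatingMap.ext fun _ ↦ rfl

/-- **`μ` is smooth on `Tq × Jσ`.** [cite: McDuffSalamon2017, Lemma 3.2.1] -/
theorem smoothAt_μ (hτs : ∀ x ∈ D.N₁, τ.SmoothAt x) {x : N} (hx : x ∈ D.Tq) {σ : ℝ} (hσ : σ ∈ Jσ) :
    (D.μ τ).SmoothAt (x, σ) :=
  smoothAt_fibrePrimitive_of_isOpen D.isOpen_Tq isOpen_Jσ (fun _ hs _ hσ' ↦ mul_mem_Jσ hs hσ')
    (fun _ hz1 hz2 ↦ D.smoothAt_η hτs hz1 hz2) hx hσ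

/-- **`dμ = η` on `Tq × Jσ`.** [cite: McDuffSalamon2017, Lemma 3.2.1] -/
theorem mextDeriv_μ (hτs : ∀ x ∈ D.N₁, τ.SmoothAt x) (hτc : ∀ x ∈ D.N₁, mextDeriv τ x = 0)
    (hτ0 : ∀ y, τ (D.b y) = 0) {x : N} (hx : x ∈ D.Tq) {σ : ℝ} (hσ : σ ∈ Jσ) :
    mextDeriv (D.μ τ) (x, σ) = D.η τ (x, σ) :=
  mextDeriv_fibrePrimitive_of_isOpen D.isOpen_Tq isOpen_Jσ (fun _ hs _ hσ' ↦ mul_mem_Jσ hs hσ')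
    (fun _ hz1 hz2 ↦ D.smoothAt_η hτs hz1 hz2) (fun _ hz1 hz2 ↦ D.mextDeriv_η hτs hτc hz1 hz2)
    (D.η_zero hτ0) hx hσ

/-- **The primitive is smooth on the quarter tube.** [folklore] -/
theorem smoothAt_prim (hτs : ∀ x ∈ D.N₁, τ.SmoothAt x) {x : N} (hx : x ∈ D.Tq) :
    (D.prim τ).SmoothAt x :=
  MForm.SmoothAt.pullback (Filter.Eventually.of_forall fun z ↦ contMDiff_ι₁ z)
    (D.smoothAt_μ hτs hx one_mem_Jσ)

/-- The primitive is smooth near the points of the quarter tube. [folklore] -/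
theorem eventually_smoothAt_prim (hτs : ∀ x ∈ D.N₁, τ.SmoothAt x) {x : N} (hx : x ∈ D.Tq) :
    ∀ᶠ z in 𝓝 x, (D.prim τ).SmoothAt z := by
  filter_upwards [D.isOpen_Tq.mem_nhds hx] with z hz
  exact D.smoothAt_prim hτs hz

/-- **`d(Sc) ∘ d(ι₁) = id` on `N₃`** (chain rule for `Sc ∘ ι₁ = (x ↦ Sc (x, 1))`, the identity near
`x`). [folklore] -/
theorem mfderiv_Sc_ι₁ {x : N} (hx : x ∈ D.Tq) (u : TangentSpace (𝓡 4) x) :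
    mfderiv ((𝓡 4).prod 𝓘(ℝ, ℝ)) (𝓡 4) D.Sc (ι₁ x) (mfderiv (𝓡 4) ((𝓡 4).prod 𝓘(ℝ, ℝ)) ι₁ x u) =
      u := by
  have hx3 := D.Tq_subset_N₃ hx
  have hSc : MDifferentiableAt ((𝓡 4).prod 𝓘(ℝ, ℝ)) (𝓡 4) D.Sc (ι₁ x) :=
    (D.contMDiffAt_Sc hx one_mem_Jσ).mdifferentiableAt (by simp)
  have hι : MDifferentiableAt (𝓡 4) ((𝓡 4).prod 𝓘(ℝ, ℝ)) ι₁ x :=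
    (contMDiff_ι₁ x).mdifferentiableAt (by simp)
  have hchain := mfderiv_comp x hSc hι
  have hid : mfderiv (𝓡 4) (𝓡 4) (D.Sc ∘ ι₁) x = ContinuousLinearMap.id ℝ (TangentSpace (𝓡 4) x) :=
    D.mfderiv_Sc_one hx3
  have heq := hchain.symm.trans hid
  have happ := congrArg (fun L : TangentSpace (𝓡 4) x →L[ℝ] TangentSpace (𝓡 4) ((D.Sc ∘ ι₁) x) ↦ L u) heq
  exact happ

/-- **The relative Poincaré lemma, derivative**: `d (prim τ) = τ` on the quarter tube.
[cite: McDuffSalamon2017, Lemma 3.2.1] -/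
theorem mextDeriv_prim (hτs : ∀ x ∈ D.N₁, τ.SmoothAt x) (hτc : ∀ x ∈ D.N₁, mextDeriv τ x = 0)
    (hτ0 : ∀ y, τ (D.b y) = 0) {x : N} (hx : x ∈ D.Tq) : mextDeriv (D.prim τ) x = τ x := by
  have hx3 := D.Tq_subset_N₃ hx
  rw [prim, mextDeriv_pullback_apply (Filter.Eventually.of_forall fun z ↦ contMDiff_ι₁ z)
    (D.smoothAt_μ hτs hx one_mem_Jσ)]
  ext v
  rw [MForm.pullback_apply]
  have hd : mextDeriv (D.μ τ) (ι₁ x) = D.η τ (x, 1) := D.mextDeriv_μ hτs hτc hτ0 hx one_mem_Jσ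
  rw [hd]
  show (τ.pullback ((𝓡 4).prod 𝓘(ℝ, ℝ)) D.Sc) (ι₁ x) _ = τ x v
  rw [MForm.pullback_apply]
  -- transport the point `Sc (x, 1) = x` and the vectors `dSc (dι₁ v i) = v i`
  have key : ∀ (p : N) (w : Fin 2 → TangentSpace (𝓡 4) p), p = x →
      (∀ i, (w i : EuclideanSpace ℝ (Fin 4)) = v i) → τ p w = τ x v := by
    rintro p w rfl hw
    have : w = v := funext hw
    rw [this]
  exact key _ _ (D.Sc_one hx3) fun i ↦ D.mfderiv_Sc_ι₁ hx (v i)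

/-- `η` on a vertical vector at the surface vanishes. [folklore] -/
theorem η_b_vertical (y : S) {s : ℝ} (hs : s ∈ Jσ)
    (w : Fin 1 → TangentSpace ((𝓡 4).prod 𝓘(ℝ, ℝ)) (D.b y, s)) :
    D.η τ (D.b y, s) (Matrix.vecCons
      (((0 : EuclideanSpace ℝ (Fin 4)), (1 : ℝ)) : TangentSpace ((𝓡 4).prod 𝓘(ℝ, ℝ)) (D.b y, s)) w) = 0 := by
  rw [η, MForm.pullback_apply]
  refine (τ _).map_coord_zero 0 ?_
  show mfderiv ((𝓡 4).prod 𝓘(ℝ, ℝ)) (𝓡 4) D.Sc (D.b y, s)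
    (((0 : EuclideanSpace ℝ (Fin 4)), (1 : ℝ)) : TangentSpace ((𝓡 4).prod 𝓘(ℝ, ℝ)) (D.b y, s)) = 0
  exact D.mfderiv_Sc_b_vertical y hs

/-- **`μ` vanishes along the surface slice**: `μ (b y, 1) = 0`. [folklore] -/
theorem μ_b (y : S) : D.μ τ (D.b y, 1) = 0 := by
  rw [μ, fibrePrimitive_apply]
  have hzero : ∀ σ ∈ uIcc (0 : ℝ) 1,
      ((((D.η τ) (D.b y, σ * 1) : (EuclideanSpace ℝ (Fin 4) × ℝ) [⋀^Fin 2]→L[ℝ] ℝ)).curryLeft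
        (((0 : EuclideanSpace ℝ (Fin 4)), (1 : ℝ)) : EuclideanSpace ℝ (Fin 4) × ℝ)).compContinuousLinearMap
        (linHom (vertQ 4) σ) = 0 := by
    intro σ hσ
    rw [uIcc_of_le zero_le_one] at hσ
    have hs : σ * 1 ∈ Jσ := by rw [mul_one]; exact Icc_subset_Jσ hσ
    ext w
    rw [ContinuousAlternatingMap.compContinuousLinearMap_apply,
      ContinuousAlternatingMap.curryLeft_apply_apply]
    exact D.η_b_vertical y hs _
  rw [intervalIntegral.integral_congr (g := fun _ ↦ 0) hzero, intervalIntegral.integral_zero]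
  rfl

/-- **The primitive vanishes at the points of the surface**: `prim τ (b y) = 0`. [folklore] -/
theorem prim_b (y : S) : D.prim τ (D.b y) = 0 := by
  show (D.μ τ (ι₁ (D.b y))).compContinuousLinearMap _ = 0
  rw [ι₁, D.μ_b y]
  exact ContinuousAlternatingMap.ext fun _ ↦ rfl

end Setup

end SurfaceTube

end Literature.Geometry.Symplectic
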